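import Summits.Ventures.HodgeRepro.Tier3OrbitPullback

/-!
# Line coefficients on night-1's model: dual functionals under re-enumeration, naturality of the wedge base
change, and the pull-back of coordinate wedges against an arbitrary enumeration of a `σ`-line

Blind re-derivation cell `pub-hodge-repro`, seat `t3-p4` (Tier 3, T3.5 for T3.4).  Target tree path
`lean/Summits/Ventures/HodgeRepro/Tier3LineCoefficients.lean`; imports the cell's `Tier3OrbitPullback` (hence
night-1's `Night1ReducedPullback`: `setDual`, `coordWedgeOn`, `pullLin`, `twistMap`, `lineSet`, `lineEnum`,
`reducedEnum`).  The helper file of `Tier3LemmaRAbstract` (LEMMA R's non-vanishing, model-free).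

WHAT THIS FILE STATES.
* `exists_perm_eq_comp_of_image_eq`, `setDual_comp_perm`, `exists_sign_setDual_eq_of_image_eq` — two injective
  enumerations of one set differ by a permutation, and their dual functionals by its sign;
  `setDual_sum_smul_coordWedgeOn` (+ `image_coe_ofFinEmbEquiv_symm`) — the dual functional of the canonical
  enumeration of `L ∈ Set.powersetCard X n` reads off the `L`-coefficient of `Σ_s c_s • e_{enum s}`.
* `baseChange_linearMap_ext`, `wedgeBaseChange_naturality` — naturality of the wedge base change of
  `Tier3WedgeBaseChange`: for `F₀`-linear `M : V → W` and base-change isomorphisms `Φ`, `Φ′` characterised on pure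
  wedges, `Φ′ ∘ (1 ⊗ ⋀ⁿ M) = ⋀ⁿ (1 ⊗ M) ∘ Φ`; `map_map_eq_of_comp_eq` — functoriality of `⋀ⁿ` for a commutative
  square.
* `setDual_map_pullLin_coordWedgeOn_eq_zero_of_image_ne`, `exists_sign_setDual_map_pullLin_coordWedgeOn_of_image_eq`
  — night-1's pull-back computation for ARBITRARY enumerations `t` of the `σ`-line and `u` of a `2k`-set: the
  `t`-coefficient of `⋀^{2k} pullLin (twistMap cls tw) (e_u)` is `0` unless `u` enumerates the reduced set `U_σ`,
  and `±1` when it does (`(cls, tw)` injective).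

HONESTY.  Linear algebra on night-1's finite coordinate model and on Mathlib; no definition is introduced; nothing
geometric is built.  HC_CM is NOT proved by anyone in this repository.
-/

set_option autoImplicit false

open TensorProduct Finset

namespace HodgeRepro.Tier3

open HodgeRepro.RouteC HodgeRepro.CMHodgeOn

/-! ### §1 Dual functionals under re-enumeration -/

section Dual

variable {X : Type*} [DecidableEq X]

/-- Two injective enumerations of one set differ by a permutation of `Fin n`. -/
theorem exists_perm_eq_comp_of_image_eq {n : ℕ} {s s' : Fin n → X} (hs : Function.Injective s)
    (hs' : Function.Injective s') (h : univ.image s = univ.image s') :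
    ∃ π : Equiv.Perm (Fin n), s' = s ∘ π := by
  classical
  have hcard : Fintype.card (↥(univ.image s)) = n := by
    rw [Fintype.card_coe, card_image_of_injective _ hs, card_univ, Fintype.card_fin]
  have hbij : Function.Bijective fun j : Fin n => (⟨s j, mem_image_of_mem s (mem_univ j)⟩ : ↥(univ.image s)) := by
    rw [Fintype.bijective_iff_injective_and_card]
    exact ⟨fun a b hab => hs (congrArg Subtype.val hab), by rw [Fintype.card_fin, hcard]⟩
  have hbij' : Function.Bijective fun j : Fin n =>
      (⟨s' j, h ▸ mem_image_of_mem s' (mem_univ j)⟩ : ↥(univ.image s)) := by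
    rw [Fintype.bijective_iff_injective_and_card]
    exact ⟨fun a b hab => hs' (congrArg Subtype.val hab), by rw [Fintype.card_fin, hcard]⟩
  let es : Fin n ≃ ↥(univ.image s) := Equiv.ofBijective _ hbij
  let es' : Fin n ≃ ↥(univ.image s) := Equiv.ofBijective _ hbij'
  refine ⟨es'.trans es.symm, ?_⟩
  funext j
  show s' j = s (es.symm (es' j))
  exact (congrArg Subtype.val (es.apply_symm_apply (es' j))).symm

omit [DecidableEq X] in
/-- The dual functional of a re-enumerated family: `setDual (s ∘ π) = sign π • setDual s`. -/
theorem setDual_comp_perm {n : ℕ} (s : Fin n → X) (π : Equiv.Perm (Fin n)) :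
    setDual (s ∘ π) = ((Equiv.Perm.sign π : ℤ) : ℂ) • setDual s := by
  unfold setDual
  have h := AlternatingMap.map_perm (exteriorPower.ιMulti ℂ n (M := Module.Dual ℂ (X → ℂ)))
    (fun j => (LinearMap.proj (s j) : (X → ℂ) →ₗ[ℂ] ℂ)) π
  rw [Units.smul_def, ← Int.cast_smul_eq_zsmul ℂ] at h
  have hfam : (fun j => (LinearMap.proj ((s ∘ π) j) : (X → ℂ) →ₗ[ℂ] ℂ)) =
      (fun j => (LinearMap.proj (s j) : (X → ℂ) →ₗ[ℂ] ℂ)) ∘ π := rfl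
  rw [hfam, h, map_smul]

/-- Two injective enumerations of one set have dual functionals differing by a sign. -/
theorem exists_sign_setDual_eq_of_image_eq {n : ℕ} {s s' : Fin n → X} (hs : Function.Injective s)
    (hs' : Function.Injective s') (h : univ.image s = univ.image s') :
    ∃ ε : ℂ, (ε = 1 ∨ ε = -1) ∧ setDual s' = ε • setDual s := by
  obtain ⟨π, hπ⟩ := exists_perm_eq_comp_of_image_eq hs hs' h
  have hsign : ((Equiv.Perm.sign π : ℤ) : ℂ) = 1 ∨ ((Equiv.Perm.sign π : ℤ) : ℂ) = -1 := by
    rcases Int.units_eq_one_or (Equiv.Perm.sign π) with h1 | h1 <;> simp [h1]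
  exact ⟨_, hsign, by rw [hπ, setDual_comp_perm]⟩

/-- The dual functional of the enumeration of `L` picks the `L`-coefficient of a combination of the
coordinate wedges of the enumerations of distinct sets. -/
theorem setDual_sum_smul_coordWedgeOn {n : ℕ} [LinearOrder X] [Fintype X]
    (c : Set.powersetCard X n → ℂ) (L : Set.powersetCard X n) :
    setDual (Set.powersetCard.ofFinEmbEquiv.symm L)
      (∑ s, c s • coordWedgeOn n (Set.powersetCard.ofFinEmbEquiv.symm s)) = c L := by
  rw [map_sum, Finset.sum_eq_single_of_mem L (Finset.mem_univ _)]
  · rw [map_smul, setDual_coordWedgeOn_self (Set.powersetCard.ofFinEmbEquiv.symm L).injective, smul_eq_mul,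
      mul_one]
  · intro s _ hs
    rw [map_smul, setDual_coordWedgeOn_of_image_ne (Set.powersetCard.ofFinEmbEquiv.symm L).injective
      (Set.powersetCard.ofFinEmbEquiv.symm s).injective, smul_zero]
    intro h
    apply hs
    apply Subtype.ext
    rw [← image_coe_ofFinEmbEquiv_symm s, ← image_coe_ofFinEmbEquiv_symm L, h]
where
  /-- The canonical enumeration of `s ∈ Set.powersetCard X n` enumerates `s` (any linearly ordered `X`). -/
  image_coe_ofFinEmbEquiv_symm (s : Set.powersetCard X n) :
      Finset.univ.image (Set.powersetCard.ofFinEmbEquiv.symm s) = (s : Finset X) := by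
    ext p
    rw [Finset.mem_image]
    constructor
    · rintro ⟨i, -, rfl⟩
      exact (Set.powersetCard.mem_range_ofFinEmbEquiv_symm_iff_mem s _).mp ⟨i, rfl⟩
    · intro hp
      obtain ⟨i, hi⟩ := (Set.powersetCard.mem_range_ofFinEmbEquiv_symm_iff_mem s p).mpr hp
      exact ⟨i, Finset.mem_univ i, hi⟩

end Dual

/-! ### §2 Naturality of the wedge base change -/

section Naturality

variable {F₀ K : Type*} [Field F₀] [Field K] [Algebra F₀ K]

/-- Two `K`-linear maps out of `K ⊗[F₀] X` agreeing on the `1 ⊗ x` agree. -/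
theorem baseChange_linearMap_ext {X Y : Type*} [AddCommGroup X] [Module F₀ X] [AddCommGroup Y] [Module K Y]
    (f g : K ⊗[F₀] X →ₗ[K] Y) (h : ∀ x : X, f ((1 : K) ⊗ₜ[F₀] x) = g ((1 : K) ⊗ₜ[F₀] x)) : f = g := by
  apply LinearMap.ext
  intro z
  induction z using TensorProduct.induction_on with
  | zero => rw [map_zero, map_zero]
  | tmul k x =>
    have hkx : k ⊗ₜ[F₀] x = k • ((1 : K) ⊗ₜ[F₀] x) := by
      rw [TensorProduct.smul_tmul', smul_eq_mul, mul_one]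
    rw [hkx, map_smul, map_smul, h]
  | add a b ha hb => rw [map_add, map_add, ha, hb]

variable {V W : Type*} [AddCommGroup V] [Module F₀ V] [AddCommGroup W] [Module F₀ W]

/-- **Naturality of the wedge base change** (`Tier3WedgeBaseChange.exists_wedgeBaseChange`): for any `F₀`-linear
`M : V → W` and base-change isomorphisms `Φ`, `Φ′` of the wedge spaces of `V`, `W`,
`Φ′ ∘ (1 ⊗ ⋀ⁿ M) = ⋀ⁿ (1 ⊗ M) ∘ Φ`. -/
theorem wedgeBaseChange_naturality (n : ℕ)
    (Φ : K ⊗[F₀] ⋀[F₀]^n V ≃ₗ[K] ⋀[K]^n (K ⊗[F₀] V))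
    (hΦ : ∀ (k : K) (v : Fin n → V),
      Φ (k ⊗ₜ[F₀] exteriorPower.ιMulti F₀ n v) = k • exteriorPower.ιMulti K n (fun i => (1 : K) ⊗ₜ[F₀] v i))
    (Φ' : K ⊗[F₀] ⋀[F₀]^n W ≃ₗ[K] ⋀[K]^n (K ⊗[F₀] W))
    (hΦ' : ∀ (k : K) (w : Fin n → W),
      Φ' (k ⊗ₜ[F₀] exteriorPower.ιMulti F₀ n w) = k • exteriorPower.ιMulti K n (fun i => (1 : K) ⊗ₜ[F₀] w i))
    (M : V →ₗ[F₀] W) (z : K ⊗[F₀] ⋀[F₀]^n V) :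
    Φ' (LinearMap.baseChange K (exteriorPower.map n M) z) =
      exteriorPower.map n (LinearMap.baseChange K M) (Φ z) := by
  suffices h : (Φ' : K ⊗[F₀] ⋀[F₀]^n W →ₗ[K] ⋀[K]^n (K ⊗[F₀] W)) ∘ₗ LinearMap.baseChange K (exteriorPower.map n M) =
      exteriorPower.map n (LinearMap.baseChange K M) ∘ₗ (Φ : K ⊗[F₀] ⋀[F₀]^n V →ₗ[K] ⋀[K]^n (K ⊗[F₀] V)) from
    LinearMap.congr_fun h z
  apply baseChange_linearMap_ext
  intro x
  have hx : x ∈ Submodule.span F₀ (Set.range (exteriorPower.ιMulti F₀ n (M := V))) := by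
    rw [exteriorPower.ιMulti_span]
    exact Submodule.mem_top
  induction hx using Submodule.span_induction with
  | mem x hx =>
    obtain ⟨v, rfl⟩ := hx
    rw [LinearMap.comp_apply, LinearMap.comp_apply, LinearEquiv.coe_coe, LinearEquiv.coe_coe,
      LinearMap.baseChange_tmul, exteriorPower.map_apply_ιMulti, hΦ', hΦ, one_smul, one_smul,
      exteriorPower.map_apply_ιMulti]
    congr 1
  | zero => rw [TensorProduct.tmul_zero, map_zero, map_zero]
  | add x y _ _ hx hy => rw [TensorProduct.tmul_add, map_add, map_add, hx, hy]
  | smul r x _ hx => rw [TensorProduct.tmul_smul, ← algebraMap_smul K r, map_smul, map_smul, hx]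

/-- Functoriality of `⋀ⁿ` for a commutative square: `g ∘ f = g′ ∘ f′ ⇒ ⋀ⁿ g (⋀ⁿ f w) = ⋀ⁿ g′ (⋀ⁿ f′ w)`. -/
theorem map_map_eq_of_comp_eq {R : Type*} [CommRing R] {M N P Q : Type*} [AddCommGroup M] [Module R M]
    [AddCommGroup N] [Module R N] [AddCommGroup P] [Module R P] [AddCommGroup Q] [Module R Q] (n : ℕ)
    (f : M →ₗ[R] N) (g : N →ₗ[R] P) (f' : M →ₗ[R] Q) (g' : Q →ₗ[R] P) (h : g ∘ₗ f = g' ∘ₗ f') (w : ⋀[R]^n M) :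
    exteriorPower.map n g (exteriorPower.map n f w) = exteriorPower.map n g' (exteriorPower.map n f' w) := by
  rw [← LinearMap.comp_apply, ← exteriorPower.map_comp, h, exteriorPower.map_comp, LinearMap.comp_apply]

end Naturality

/-! ### §3 The pull-back of coordinate wedges against an arbitrary enumeration of a `σ`-line -/

section PullLine

variable {G : Type*} [Group G] [DecidableEq G] [Fintype G] {ι J : Type*} [Fintype ι] [DecidableEq ι]
  [DecidableEq J]

/-- The dual functional of any enumeration `t` of the `σ`-line kills the pull-back of the coordinate wedge of any
enumeration `u` of a set other than `U_σ` (`Tier3OrbitPullback.wedgeComponent_lineEnum_map_pullLin_coordWedgeOn_of_ne`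
for an arbitrary enumeration of the line). -/
theorem setDual_map_pullLin_coordWedgeOn_eq_zero_of_image_ne {cls : ι → J} {tw : ι → G} {k : ℕ} {σ : G}
    {t : Fin (2 * k) → ι × G} (ht : Function.Injective t) (htimg : univ.image t = lineSet σ)
    {u : Fin (2 * k) → J × G} (hu : Function.Injective u) (hne : univ.image u ≠ reducedSet cls tw σ) :
    setDual t (exteriorPower.map (2 * k) (pullLin (twistMap cls tw)) (coordWedgeOn (2 * k) u)) = 0 := by
  rw [map_pullLin_coordWedgeOn, map_sum, Finset.sum_eq_zero]
  intro ℓ hℓ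
  have hθℓ : twistMap cls tw ∘ ℓ = u := by
    funext j
    have := (Fintype.mem_piFinset.mp hℓ) j
    simpa using this
  have hℓinj : Function.Injective ℓ := by
    intro a b h
    apply hu
    rw [← hθℓ]
    simp [h]
  apply setDual_coordWedgeOn_of_image_ne ht hℓinj
  intro himg
  apply hne
  rw [← hθℓ, ← Finset.image_image, ← himg, htimg, image_lineSet_twistMap]

omit [Fintype G] in
/-- The dual functional of any enumeration `t` of the `σ`-line takes the value `±1` on the pull-back of the
coordinate wedge of any enumeration `u` of the reduced set `U_σ` (`(cls, tw)` injective): night-1's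
`setDual_lineEnum_map_pullLin_reducedWedge` (coefficient `1` for its enumerations) up to the two re-enumeration
signs. -/
theorem exists_sign_setDual_map_pullLin_coordWedgeOn_of_image_eq {cls : ι → J} {tw : ι → G}
    (hinj : Function.Injective fun i => (cls i, tw i)) {k : ℕ} (e₀ : Fin (2 * k) ≃ ι) (σ : G)
    {t : Fin (2 * k) → ι × G} (ht : Function.Injective t) (htimg : univ.image t = lineSet σ)
    {u : Fin (2 * k) → J × G} (hu : Function.Injective u) (huimg : univ.image u = reducedSet cls tw σ) :
    ∃ ε : ℂ, (ε = 1 ∨ ε = -1) ∧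
      setDual t (exteriorPower.map (2 * k) (pullLin (twistMap cls tw)) (coordWedgeOn (2 * k) u)) = ε := by
  obtain ⟨ε₁, hε₁, h₁⟩ := exists_sign_setDual_eq_of_image_eq (lineEnum_injective e₀ σ) ht
    (by rw [image_lineEnum, htimg])
  obtain ⟨π, hπ⟩ := coordWedgeOn_eq_sign_smul_of_image_eq (reducedEnum_injective hinj e₀ σ) hu
    (by rw [image_reducedEnum, huimg])
  refine ⟨ε₁ * ((Equiv.Perm.sign π : ℤ) : ℂ), ?_, ?_⟩
  · rcases hε₁ with rfl | rfl <;> rcases Int.units_eq_one_or (Equiv.Perm.sign π) with h | h <;> simp [h]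
  · rw [h₁, hπ, map_smul, map_smul, LinearMap.smul_apply, setDual_lineEnum_map_pullLin_reducedWedge hinj e₀ σ,
      smul_eq_mul, smul_eq_mul, mul_one, mul_comm]

end PullLine

end HodgeRepro.Tier3
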